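import Summits.Langlands.Langlands.Theses.MirrorPairReflection

/-!
# BC3 birth skeleton — child `PairCompatibilityAllData` of the BC2-redirect split of `MirrorPairReflection.SectorComplement`
(crux stmt-Langlands-12840; crux-strategist `cstrat-stmt-Langlands-12840-r1`, 2026-08-17)

`PairCompatibilityAllData` (L — Taylor 2004 Conj. 7 for irreducible pinned-geometric a.e.-compatible pairs at EVERY finite place,
for EVERY reciprocity datum `Rec`: the registered stub `stub_pairCompatibility` of lines birth_MirrorPairReflection / Sketch (14328)
re-typed `∃ Rec ↦ ∀ Rec` in lockstep with the statement revision p141787 — the pins `llc_isCanonical` / `llc_eps_isCanonical`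
make every `Rec` Henniart-normalised).  Cut, as the lead line on stmt-Langlands-14328 cuts it, into AWAY FROM `ℓ` (Grothendieck–Deligne
side: Carayol, Harris–Taylor Thm A/B, Taylor–Yoshida, Caraiani, Varma 2024) and ABOVE `ℓ` (Fontaine's pinned `D_pst`: Saito, Kisin,
BLGGT, Caraiani, A'Campo), the latter for every `Rec` already compatible away from `ℓ`; both `∀ Rec`.

Shape: ≥ 2 NAMED stubs `stub_*` (the ONLY sorries of this file) and the kernel-checked composition
`PairCompatibilityAllData_of : <stub₁-sig> → <stub₂-sig> → PairCompatibilityAllData` (+ `PairCompatibilityAllData_of_stubs`).  Context = the route file's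
(the child is restated here VERBATIM from children.json; after `route edit --split` it is the route's own decl
`Summit.Langlands.Langlands.Theses.MirrorPairReflection.PairCompatibilityAllData` and this local copy is deleted — post-split
version `post/birth_PairCompatibilityAllData.lean` in the planner folder).
-/

noncomputable section

set_option linter.dupNamespace false

namespace Summit.Langlands.Langlands.Theses.MirrorPairReflection

open scoped BigOperators Topology Manifold Classical MeasureTheory ProbabilityTheory Matrix InnerProductSpace ComplexConjugate ContinuousMap
open Filter Set Function TopologicalSpace MeasureTheory

/-- child `PairCompatibilityAllData` (children.json statement VERBATIM). -/
def PairCompatibilityAllData : Prop :=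
  ∀ (K : Type) [Field K] [NumberField K] (Rec : ReciprocityData K) (n : ℕ) (hcpt : Literature.NumberTheory.Automorphic.isCompact_glFiniteIntegralLevel n K), 0 < n → ∀ (π : Literature.NumberTheory.Automorphic.CuspidalAutomorphicRepData n K hcpt), π.1.IsLAlgebraic → ∀ (ℓ : ℕ) [Fact ℓ.Prime] (ι : PadicAlgCl ℓ ≃+* ℂ) (ρ : Literature.NumberTheory.GaloisRepresentations.FramedGaloisRep K (PadicAlgCl ℓ) n), ρ.toGaloisRep.IsIrreducible → ((∀ᶠ v : IsDedekindDomain.HeightOneSpectrum (NumberField.RingOfIntegers K) in cofinite, ρ.IsUnramifiedAt v) ∧ ∀ (v : IsDedekindDomain.HeightOneSpectrum (NumberField.RingOfIntegers K)) (hv : ((ℓ : ℕ) : NumberField.RingOfIntegers K) ∈ v.asIdeal), (Literature.NumberTheory.PAdicHodge.fontainePstAdicCompletion v ℓ hv).IsDeRhamFramed (ρ.toLocal v)) → (∀ᶠ v : IsDedekindDomain.HeightOneSpectrum (NumberField.RingOfIntegers K) in cofinite, SatakeFrobCompatibleAt ι π.1 ρ v) → ∀ v : IsDedekindDomain.HeightOneSpectrum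 (NumberField.RingOfIntegers K), LocalGlobalCompatibleAt Rec ι π.1 ρ v

namespace Cruxes.PairCompatibilityAllData.Birth

/-- **stub L-away (OPEN: Taylor 2004 Conj. 7 at `v ∤ ℓ` for irreducible pairs, for EVERY reciprocity datum)** — the
`∀ Rec` form of the registered stub `stub_pairCompatibilityAway` (14328 / Sketch).  Why it might fail: beyond the printed
conjecture it carries the Henniart-uniqueness exposure of `∀ Rec` (a lawful `ReciprocityData` whose `rec_v` is wrong on a
generic non-supercuspidal class would refute it; the pins + `IsLocalLanglandsGL` are believed to exclude this).
[cite: TaylorGaloisRepresentations2004, Conj. 7] [cite: HarrisTaylorAMS2001, Thm. A] [cite: VarmaFMS2024, Thm. 1] -/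
theorem stub_pairCompatibilityAway_allData :
    ∀ (K : Type) [Field K] [NumberField K] (Rec : ReciprocityData K) (n : ℕ) (hcpt : Literature.NumberTheory.Automorphic.isCompact_glFiniteIntegralLevel n K), 0 < n → ∀ (π : Literature.NumberTheory.Automorphic.CuspidalAutomorphicRepData n K hcpt), π.1.IsLAlgebraic → ∀ (ℓ : ℕ) [Fact ℓ.Prime] (ι : PadicAlgCl ℓ ≃+* ℂ) (ρ : Literature.NumberTheory.GaloisRepresentations.FramedGaloisRep K (PadicAlgCl ℓ) n), ρ.toGaloisRep.IsIrreducible → ((∀ᶠ v : IsDedekindDomain.HeightOneSpectrum (NumberField.RingOfIntegers K) in cofinite, ρ.IsUnramifiedAt v) ∧ ∀ (v : IsDedekindDomain.HeightOneSpectrum (NumberField.RingOfIntegers K)) (hv : ((ℓ : ℕ) : NumberField.RingOfIntegers K) ∈ v.asIdeal), (Literature.NumberTheory.PAdicHodge.fontainePstAdicCompletion v ℓ hv).IsDeRhamFramed (ρ.toLocal v)) → (∀ᶠ v : IsDedekindDomain.HeightOneSpectrum (NumberField.RingOfIntegers K) in cofinite, SatakeFrobCompatibleAt ι π.1 ρ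 v) → ∀ v : IsDedekindDomain.HeightOneSpectrum (NumberField.RingOfIntegers K), ((ℓ : ℕ) : NumberField.RingOfIntegers K) ∉ v.asIdeal → LocalGlobalCompatibleAt Rec ι π.1 ρ v := by
  sorry

/-- **stub L-above (OPEN and formally blocked on `defn-FontainePstWeilDeligneData` D1/D2: Taylor 2004 Conj. 7 at `v ∣ ℓ`
through Fontaine's pinned `D_pst`, for every `Rec` already compatible away from `ℓ`)** — the `∀ Rec` form of the registered
stub `stub_pairCompatibilityAbove` (14328 / Sketch).  [cite: FontaineAsterisque223VIII, §2.3.7] [cite: HarrisTaylorAMS2001, Thm. A] -/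
theorem stub_pairCompatibilityAbove_allData :
    ∀ (K : Type) [Field K] [NumberField K] (Rec : ReciprocityData K), (∀ (n : ℕ) (hcpt : Literature.NumberTheory.Automorphic.isCompact_glFiniteIntegralLevel n K), 0 < n → ∀ (π : Literature.NumberTheory.Automorphic.CuspidalAutomorphicRepData n K hcpt), π.1.IsLAlgebraic → ∀ (ℓ : ℕ) [Fact ℓ.Prime] (ι : PadicAlgCl ℓ ≃+* ℂ) (ρ : Literature.NumberTheory.GaloisRepresentations.FramedGaloisRep K (PadicAlgCl ℓ) n), ρ.toGaloisRep.IsIrreducible → ((∀ᶠ v : IsDedekindDomain.HeightOneSpectrum (NumberField.RingOfIntegers K) in cofinite, ρ.IsUnramifiedAt v) ∧ ∀ (v : IsDedekindDomain.HeightOneSpectrum (NumberField.RingOfIntegers K)) (hv : ((ℓ : ℕ) : NumberField.RingOfIntegers K) ∈ v.asIdeal), (Literature.NumberTheory.PAdicHodge.fontainePstAdicCompletion v ℓ hv).IsDeRhamFramed (ρ.toLocal v)) → (∀ᶠ v : IsDedekindDomain.HeightOneSpectrum (NumberField.RingOfIntegers K) in cofinite, SatakeFrobCompatibleAt ι π.1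 ρ v) → ∀ v : IsDedekindDomain.HeightOneSpectrum (NumberField.RingOfIntegers K), ((ℓ : ℕ) : NumberField.RingOfIntegers K) ∉ v.asIdeal → LocalGlobalCompatibleAt Rec ι π.1 ρ v) → ∀ (n : ℕ) (hcpt : Literature.NumberTheory.Automorphic.isCompact_glFiniteIntegralLevel n K), 0 < n → ∀ (π : Literature.NumberTheory.Automorphic.CuspidalAutomorphicRepData n K hcpt), π.1.IsLAlgebraic → ∀ (ℓ : ℕ) [Fact ℓ.Prime] (ι : PadicAlgCl ℓ ≃+* ℂ) (ρ : Literature.NumberTheory.GaloisRepresentations.FramedGaloisRep K (PadicAlgCl ℓ) n), ρ.toGaloisRep.IsIrreducible → ((∀ᶠ v : IsDedekindDomain.HeightOneSpectrum (NumberField.RingOfIntegers K) in cofinite, ρ.IsUnramifiedAt v) ∧ ∀ (v : IsDedekindDomain.HeightOneSpectrum (NumberField.RingOfIntegers K)) (hv : ((ℓ : ℕ) : NumberField.RingOfIntegers K) ∈ v.asIdeal), (Literature.NumberTheory.PAdicHodge.fontainePstAdicCompletion v ℓ hv).IsDeRhamFramed (ρ.toLocal v)) → (∀ᶠ v : IsDedekindDomain.HeightOneSpectrum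 (NumberField.RingOfIntegers K) in cofinite, SatakeFrobCompatibleAt ι π.1 ρ v) → ∀ v : IsDedekindDomain.HeightOneSpectrum (NumberField.RingOfIntegers K), ((ℓ : ℕ) : NumberField.RingOfIntegers K) ∈ v.asIdeal → LocalGlobalCompatibleAt Rec ι π.1 ρ v := by
  sorry

/-- **L from its away/above halves** (case split on `ℓ ∈ v`). -/
theorem PairCompatibilityAllData_of :
    (∀ (K : Type) [Field K] [NumberField K] (Rec : ReciprocityData K) (n : ℕ) (hcpt : Literature.NumberTheory.Automorphic.isCompact_glFiniteIntegralLevel n K), 0 < n → ∀ (π : Literature.NumberTheory.Automorphic.CuspidalAutomorphicRepData n K hcpt), π.1.IsLAlgebraic → ∀ (ℓ : ℕ) [Fact ℓ.Prime] (ι : PadicAlgCl ℓ ≃+* ℂ) (ρ : Literature.NumberTheory.GaloisRepresentations.FramedGaloisRep K (PadicAlgCl ℓ) n), ρ.toGaloisRep.IsIrreducible → ((∀ᶠ v : IsDedekindDomain.HeightOneSpectrum (NumberField.RingOfIntegers K) in cofinite, ρ.IsUnramifiedAt v) ∧ ∀ (v : IsDedekindDomain.HeightOneSpectrum (NumberField.RingOfIntegers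 K)) (hv : ((ℓ : ℕ) : NumberField.RingOfIntegers K) ∈ v.asIdeal), (Literature.NumberTheory.PAdicHodge.fontainePstAdicCompletion v ℓ hv).IsDeRhamFramed (ρ.toLocal v)) → (∀ᶠ v : IsDedekindDomain.HeightOneSpectrum (NumberField.RingOfIntegers K) in cofinite, SatakeFrobCompatibleAt ι π.1 ρ v) → ∀ v : IsDedekindDomain.HeightOneSpectrum (NumberField.RingOfIntegers K), ((ℓ : ℕ) : NumberField.RingOfIntegers K) ∉ v.asIdeal → LocalGlobalCompatibleAt Rec ι π.1 ρ v) →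
    (∀ (K : Type) [Field K] [NumberField K] (Rec : ReciprocityData K), (∀ (n : ℕ) (hcpt : Literature.NumberTheory.Automorphic.isCompact_glFiniteIntegralLevel n K), 0 < n → ∀ (π : Literature.NumberTheory.Automorphic.CuspidalAutomorphicRepData n K hcpt), π.1.IsLAlgebraic → ∀ (ℓ : ℕ) [Fact ℓ.Prime] (ι : PadicAlgCl ℓ ≃+* ℂ) (ρ : Literature.NumberTheory.GaloisRepresentations.FramedGaloisRep K (PadicAlgCl ℓ) n), ρ.toGaloisRep.IsIrreducible → ((∀ᶠ v : IsDedekindDomain.HeightOneSpectrum (NumberField.RingOfIntegers K) in cofinite, ρ.IsUnramifiedAt v) ∧ ∀ (v : IsDedekindDomain.HeightOneSpectrum (NumberField.RingOfIntegers K)) (hv : ((ℓ : ℕ) : NumberField.RingOfIntegers K) ∈ v.asIdeal), (Literature.NumberTheory.PAdicHodge.fontainePstAdicCompletion v ℓ hv).IsDeRhamFramed (ρ.toLocal v)) → (∀ᶠ v : IsDedekindDomain.HeightOneSpectrum (NumberField.RingOfIntegers K) in cofinite, SatakeFrobCompatibleAt ι π.1 ρ v) → ∀ v : IsDedekindDomain.HeightOneSpectrum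 (NumberField.RingOfIntegers K), ((ℓ : ℕ) : NumberField.RingOfIntegers K) ∉ v.asIdeal → LocalGlobalCompatibleAt Rec ι π.1 ρ v) → ∀ (n : ℕ) (hcpt : Literature.NumberTheory.Automorphic.isCompact_glFiniteIntegralLevel n K), 0 < n → ∀ (π : Literature.NumberTheory.Automorphic.CuspidalAutomorphicRepData n K hcpt), π.1.IsLAlgebraic → ∀ (ℓ : ℕ) [Fact ℓ.Prime] (ι : PadicAlgCl ℓ ≃+* ℂ) (ρ : Literature.NumberTheory.GaloisRepresentations.FramedGaloisRep K (PadicAlgCl ℓ) n), ρ.toGaloisRep.IsIrreducible → ((∀ᶠ v : IsDedekindDomain.HeightOneSpectrum (NumberField.RingOfIntegers K) in cofinite, ρ.IsUnramifiedAt v) ∧ ∀ (v : IsDedekindDomain.HeightOneSpectrum (NumberField.RingOfIntegers K)) (hv : ((ℓ : ℕ) : NumberField.RingOfIntegers K) ∈ v.asIdeal), (Literature.NumberTheory.PAdicHodge.fontainePstAdicCompletion v ℓ hv).IsDeRhamFramed (ρ.toLocal v)) → (∀ᶠ v : IsDedekindDomain.HeightOneSpectrum (NumberField.RingOfIntegers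 K) in cofinite, SatakeFrobCompatibleAt ι π.1 ρ v) → ∀ v : IsDedekindDomain.HeightOneSpectrum (NumberField.RingOfIntegers K), ((ℓ : ℕ) : NumberField.RingOfIntegers K) ∈ v.asIdeal → LocalGlobalCompatibleAt Rec ι π.1 ρ v) →
    PairCompatibilityAllData := by
  intro h1 h2 K _ _ Rec n hcpt hn π hπ ℓ _ ι ρ hirr hgeo hρ v
  by_cases hv : ((ℓ : ℕ) : NumberField.RingOfIntegers K) ∈ v.asIdeal
  · exact h2 K Rec (fun n hcpt hn π hπ ℓ _ ι ρ hirr hgeo hρ v hv => h1 K Rec n hcpt hn π hπ ℓ ι ρ hirr hgeo hρ v hv)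
      n hcpt hn π hπ ℓ ι ρ hirr hgeo hρ v hv
  · exact h1 K Rec n hcpt hn π hπ ℓ ι ρ hirr hgeo hρ v hv

/-- The composition with the stubs plugged in. -/
theorem PairCompatibilityAllData_of_stubs : PairCompatibilityAllData :=
  PairCompatibilityAllData_of stub_pairCompatibilityAway_allData stub_pairCompatibilityAbove_allData

end Cruxes.PairCompatibilityAllData.Birth

end Summit.Langlands.Langlands.Theses.MirrorPairReflection

end
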